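import Literature.AlgebraicGeometry.AbelianSchemes.AbelianSchemeFibreHom
import Literature.AlgebraicGeometry.AbelianSchemes.AbelianSchemeOverSectionPow
import HarnessLib

/-!
# The two currencies for geometric fibre points of an abelian scheme — `X_s(Ω) = Hom_S(Spec Ω, X)` and the `Ω`-points
# of the fibre variety `X ×_S Spec Ω` — and the homomorphism of fibres `u_s` read in both
# ([GortzWedhorn2020] (4.7); [MumfordFogartyKirwan1994] Ch. 6 §2 Def. 6.3, Ch. 7 §2 Def. 7.1)

[GortzWedhorn2020, Section (4.7), (4.7.1) (p. 108)]: for an `S`-scheme `X` and `S′ → S`, `Hom_S(T, X) ≅ Hom_{S′}(T, X ×_S S′)`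
for every `S′`-scheme `T`.  With `S′ = T = Spec Ω` (a field-valued point `s : Spec Ω → S`) the two sides are the tree's two
currencies for the group `X_s(Ω)`: the `FibrePoints` `x : Spec Ω →_S X` over `s` (★ `AbelianSchemeOver.FibrePoints`, the
currency of the basis clauses of a level structure, of ★ `LevelStructureOfIsogeny` and of the quotient file ★
`AbelianSchemeConstSubgroupQuotient`: «`x ≫ ψ = y`», «`x ≫ ψ = 1 ↔ x = σ(s)`»), and the `Ω`-POINTS of the fibre abelian
variety `(A.fibre s).toAbelianVariety` (★ `AbelianVariety.Points`, the currency of Weil pairings, symplectic lifts and ★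
`fibreHom u s`: «`AlgPoints.map (fibreHom u s) P`»).  The dictionary is the relation **`A.fibrePointToLeft s P = x.left`**
(«`P` and `x` have the same underlying point `Spec Ω → X`»); this file proves it is a bijective correspondence compatible
with sections (`restrictPt ↔ restrict`), with units, and with a homomorphism `u : A → B` (`AlgPoints.map (fibreHom u s)`
↔ `· ≫ u`, ★ `fibrePointToLeft_map_fibreHom`), and transports the two export clauses of a quotient map across it:
* `exists_points_fibrePointToLeft_eq` / `exists_fibrePoints_fibrePointToLeft_eq` — every fibre point has a partner;
* `points_eq_of_fibrePointToLeft_eq` / `fibrePoints_eq_of_fibrePointToLeft_eq` — partners are unique;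
* `fibrePointToLeft_restrictPt`, `fibrePointToLeft_one_eq`, `fibrePointToLeft_map_fibreHom_eq_comp_left` — sections, units, `u`;
* **`surjective_map_fibreHom_of_forall_fibrePoints`** — «`u` onto on geometric fibre points» (`∀ y, ∃ x, x ≫ u = y`) ⟹
  `AlgPoints.map (fibreHom u s)` surjective;
* **`map_fibreHom_eq_one_iff_of_fibrePoints`** — «kernel of `u` on geometric fibre points = the sections `K`»
  (`x ≫ u = 1 ↔ ∃ σ ∈ K, x = σ|s`) ⟹ `AlgPoints.map (fibreHom u s) P = 1 ↔ ∃ σ ∈ K, P = σ(s)`.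
Consumers: the `hsurj`/`hker` binders of ★ `SymplecticLiftOfIsogenyQuotient` (the `symplectic` field of a Hecke isogeny
quotient) fed from the export clauses of ★ `AbelianSchemeConstSubgroupQuotient`.  Theorems only; cell hodgecm-mathlib, seat
B-p04 (g17).  HC_CM is proved only modulo the 7 printed citations until rung 0 closes; this file discharges none of them.

## References
* [GortzWedhorn2020] U. Görtz, T. Wedhorn, *Algebraic Geometry I*, 2nd ed. (2020), Section (4.7), (4.7.1) (p. 108).
* [MumfordFogartyKirwan1994] D. Mumford, J. Fogarty, F. Kirwan, *Geometric Invariant Theory*, 3rd ed. (1994), Ch. 6 §2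
  Def. 6.3 (p. 120); Ch. 7 §2 Def. 7.1 (p. 129).
-/

noncomputable section

universe u

open CategoryTheory CategoryTheory.Limits AlgebraicGeometry MonoidalCategory
open scoped MonObj

namespace Literature.AlgebraicGeometry.AbelianSchemes

namespace AbelianSchemeOver

open Literature.AlgebraicGeometry.Motives

variable {S : Scheme.{u}} (A : AbelianSchemeOver S) {B : AbelianSchemeOver S} {Ω : Type u} [Field Ω]
  (s : Spec (.of Ω) ⟶ S)

/-! ### §1 The correspondence `fibrePointToLeft s P = x.left` is a bijection -/

/-- **Every `S`-point `x : Spec Ω →_S X` over `s` is the underlying point of an `Ω`-point of the fibre `X ×_S Spec Ω`**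
(the section `(x, 𝟙)` of `X ×_S Spec Ω → Spec Ω`; [GortzWedhorn2020] (4.7.1), surjectivity).
[cite: GortzWedhorn2020, Section (4.7), (4.7.1) (p. 108)] -/
theorem exists_points_fibrePointToLeft_eq (x : A.FibrePoints s) :
    ∃ P : (A.fibre s).toAbelianVariety.Points Ω, A.fibrePointToLeft s P = x.left := by
  have hx : x.left ≫ A.X.hom = 𝟙 _ ≫ s := by rw [Category.id_comp]; exact Over.w x
  refine ⟨AlgPoints.mk (pullback.lift x.left (𝟙 _) hx) ?_, ?_⟩
  · change pullback.lift _ _ _ ≫ pullback.snd A.X.hom s = _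
    rw [pullback.lift_snd, Algebra.algebraMap_self, CommRingCat.ofHom_id, Spec.map_id]
  · exact pullback.lift_fst _ _ _

/-- **Every `Ω`-point of the fibre is the partner of an `S`-point over `s`** — namely of its underlying point
`fibrePointToLeft s P` ([GortzWedhorn2020] (4.7.1), the other direction). [cite: GortzWedhorn2020, Section (4.7), (4.7.1) (p. 108)] -/
theorem exists_fibrePoints_fibrePointToLeft_eq (P : (A.fibre s).toAbelianVariety.Points Ω) :
    ∃ x : A.FibrePoints s, A.fibrePointToLeft s P = x.left :=
  ⟨Over.homMk (A.fibrePointToLeft s P) (A.fibrePointToLeft_comp_hom s P), rfl⟩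

/-- Partners are unique on the fibre side (★ `fibrePointToLeft_injective`). [cite: GortzWedhorn2020, Section (4.7), (4.7.1) (p. 108)] -/
theorem points_eq_of_fibrePointToLeft_eq {P P' : (A.fibre s).toAbelianVariety.Points Ω} {x : A.FibrePoints s}
    (hP : A.fibrePointToLeft s P = x.left) (hP' : A.fibrePointToLeft s P' = x.left) : P = P' :=
  A.fibrePointToLeft_injective s (hP.trans hP'.symm)

/-- Partners are unique on the `S`-side (a morphism over `S` is determined by its underlying morphism).
[cite: GortzWedhorn2020, Section (4.7), (4.7.1) (p. 108)] -/
theorem fibrePoints_eq_of_fibrePointToLeft_eq {P : (A.fibre s).toAbelianVariety.Points Ω} {x x' : A.FibrePoints s}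
    (hx : A.fibrePointToLeft s P = x.left) (hx' : A.fibrePointToLeft s P = x'.left) : x = x' :=
  Over.OverMorphism.ext (hx.symm.trans hx')

/-! ### §2 Compatibility with sections, units and homomorphisms -/

/-- **Sections**: `σ(s)` (★ `restrictPt`) and `σ|s` (★ `restrict`) are partners — both lie over `s ≫ σ`.
[cite: MumfordFogartyKirwan1994, Ch. 7 §2 Definition 7.1 (p. 129)] -/
theorem fibrePointToLeft_restrictPt (σ : A.Sections) :
    A.fibrePointToLeft s (A.restrictPt s σ) = (A.restrict s σ).left := by
  change (A.restrictPt s σ).left ≫ pullback.fst A.X.hom s = _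
  rw [restrictPt_left_fst, restrict_left]

/-- **Units**: `1 ∈ A_s(Ω)` and `1 ∈ X_s(Ω)` are partners (both are the restriction of the identity section).
[cite: MumfordFogartyKirwan1994, Ch. 6 §1 Definition 6.1 (p. 115)] -/
theorem fibrePointToLeft_one_eq :
    A.fibrePointToLeft s (1 : (A.fibre s).toAbelianVariety.Points Ω) = (1 : A.FibrePoints s).left := by
  exact (congrArg (A.fibrePointToLeft s) (A.restrictPt_one s)).symm.trans
    ((A.fibrePointToLeft_restrictPt s 1).trans (congrArg (fun t => t.left) (A.restrict_one s)))

variable {A}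

/-- **Homomorphisms**: if `P` and `x` are partners then `u_s(P)` and `x ≫ u` are partners (★ `fibrePointToLeft_map_fibreHom`).
[cite: MumfordFogartyKirwan1994, Ch. 6 §2 Definition 6.3 (p. 120)] -/
theorem fibrePointToLeft_map_fibreHom_eq_comp_left (u : A.X ⟶ B.X) [IsMonHom u]
    {P : (A.fibre s).toAbelianVariety.Points Ω} {x : A.FibrePoints s} (h : A.fibrePointToLeft s P = x.left) :
    B.fibrePointToLeft s (AlgPoints.map (fibreHom u s).hom.hom.hom P) = (x ≫ u).left := by
  rw [fibrePointToLeft_map_fibreHom, h, Over.comp_left]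
  rfl

/-- `u_s(P) = 1` iff `x ≫ u = 1`, for partners `P`, `x`. [cite: MumfordFogartyKirwan1994, Ch. 6 §2 Definition 6.3 (p. 120)] -/
theorem map_fibreHom_eq_one_iff_comp_eq_one (u : A.X ⟶ B.X) [IsMonHom u]
    {P : (A.fibre s).toAbelianVariety.Points Ω} {x : A.FibrePoints s} (h : A.fibrePointToLeft s P = x.left) :
    AlgPoints.map (fibreHom u s).hom.hom.hom P = 1 ↔ x ≫ u = 1 := by
  have hu := fibrePointToLeft_map_fibreHom_eq_comp_left s u h
  have h1 := B.fibrePointToLeft_one_eq s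
  constructor
  · intro hP
    rw [hP] at hu
    exact B.fibrePoints_eq_of_fibrePointToLeft_eq s hu h1
  · intro hx
    rw [hx] at hu
    exact B.points_eq_of_fibrePointToLeft_eq s hu h1

/-- `P = σ(s)` iff `x = σ|s`, for partners `P`, `x`. [cite: MumfordFogartyKirwan1994, Ch. 7 §2 Definition 7.1 (p. 129)] -/
theorem eq_restrictPt_iff_eq_restrict {P : (A.fibre s).toAbelianVariety.Points Ω} {x : A.FibrePoints s}
    (h : A.fibrePointToLeft s P = x.left) (σ : A.Sections) :
    P = A.restrictPt s σ ↔ x = A.restrict s σ := by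
  have hσ := A.fibrePointToLeft_restrictPt s σ
  constructor
  · intro hP
    rw [hP] at h
    exact A.fibrePoints_eq_of_fibrePointToLeft_eq s h hσ
  · intro hx
    rw [hx] at h
    exact A.points_eq_of_fibrePointToLeft_eq s h hσ

/-! ### §3 Transport of the two export clauses of a quotient map -/

/-- **«`u` ONTO on geometric fibre points» in `FibrePoints` currency ⟹ `u_s` onto on `Ω`-points of the fibre**
(`∀ y, ∃ x, x ≫ u = y` ⟹ `AlgPoints.map (fibreHom u s)` surjective) — the `hsurj` binder of the Hecke isogeny-quotient
liftability (★ `SymplecticLiftOfIsogenyQuotient`) from the export of ★ `AbelianSchemeConstSubgroupQuotient`.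
[cite: GortzWedhorn2020, Section (4.7), (4.7.1) (p. 108)] [cite: MumfordFogartyKirwan1994, Ch. 6 §2 Definition 6.3 (p. 120)] -/
theorem surjective_map_fibreHom_of_forall_fibrePoints (u : A.X ⟶ B.X) [IsMonHom u]
    (h : ∀ y : B.FibrePoints s, ∃ x : A.FibrePoints s, x ≫ u = y) :
    Function.Surjective (AlgPoints.map (L := Ω) (fibreHom u s).hom.hom.hom) := by
  intro Q
  obtain ⟨y, hy⟩ := B.exists_fibrePoints_fibrePointToLeft_eq s Q
  obtain ⟨x, hx⟩ := h y
  obtain ⟨P, hP⟩ := A.exists_points_fibrePointToLeft_eq s x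
  refine ⟨P, ?_⟩
  have hu := fibrePointToLeft_map_fibreHom_eq_comp_left s u hP
  rw [hx] at hu
  exact B.points_eq_of_fibrePointToLeft_eq s hu hy

/-- **«KERNEL of `u` on geometric fibre points = the sections `K`» in `FibrePoints` currency ⟹ the same on `Ω`-points of
the fibre**: from `x ≫ u = 1 ↔ ∃ σ ∈ K, x = σ|s` to `u_s(P) = 1 ↔ ∃ σ ∈ K, P = σ(s)` — the `hker` binder of ★
`SymplecticLiftOfIsogenyQuotient` from the exact-kernel export of the quotient file.
[cite: GortzWedhorn2020, Section (4.7), (4.7.1) (p. 108)] [cite: MumfordFogartyKirwan1994, Ch. 7 §2 Definition 7.1 (p. 129)] -/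
theorem map_fibreHom_eq_one_iff_of_fibrePoints (u : A.X ⟶ B.X) [IsMonHom u] (K : Set A.Sections)
    (h : ∀ x : A.FibrePoints s, x ≫ u = 1 ↔ ∃ σ ∈ K, x = A.restrict s σ)
    (P : (A.fibre s).toAbelianVariety.Points Ω) :
    AlgPoints.map (fibreHom u s).hom.hom.hom P = 1 ↔ ∃ σ ∈ K, P = A.restrictPt s σ := by
  obtain ⟨x, hx⟩ := A.exists_fibrePoints_fibrePointToLeft_eq s P
  rw [map_fibreHom_eq_one_iff_comp_eq_one s u hx, h x]
  constructor
  · rintro ⟨σ, hσ, hxσ⟩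
    exact ⟨σ, hσ, (eq_restrictPt_iff_eq_restrict s hx σ).2 hxσ⟩
  · rintro ⟨σ, hσ, hPσ⟩
    exact ⟨σ, hσ, (eq_restrictPt_iff_eq_restrict s hx σ).1 hPσ⟩

/-- The exact-kernel clause with `K` the image of an index set under a family of sections (e.g. `K = φ′(K₀)` for a
level structure `φ′` and `K₀ ⊆ (ℤ/N′)^{2g}`): `u_s(P) = 1 ↔ ∃ c ∈ K₀, P = φ′(c)(s)`.
[cite: MumfordFogartyKirwan1994, Ch. 7 §2 Definition 7.1 (p. 129)] -/
theorem map_fibreHom_eq_one_iff_of_fibrePoints_range {J : Type*} (u : A.X ⟶ B.X) [IsMonHom u] (K₀ : Set J)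
    (sec : J → A.Sections)
    (h : ∀ x : A.FibrePoints s, x ≫ u = 1 ↔ ∃ c ∈ K₀, x = A.restrict s (sec c))
    (P : (A.fibre s).toAbelianVariety.Points Ω) :
    AlgPoints.map (fibreHom u s).hom.hom.hom P = 1 ↔ ∃ c ∈ K₀, P = A.restrictPt s (sec c) := by
  obtain ⟨x, hx⟩ := A.exists_fibrePoints_fibrePointToLeft_eq s P
  rw [map_fibreHom_eq_one_iff_comp_eq_one s u hx, h x]
  constructor
  · rintro ⟨c, hc, hxc⟩
    exact ⟨c, hc, (eq_restrictPt_iff_eq_restrict s hx (sec c)).2 hxc⟩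
  · rintro ⟨c, hc, hPc⟩
    exact ⟨c, hc, (eq_restrictPt_iff_eq_restrict s hx (sec c)).1 hPc⟩

end AbelianSchemeOver

end Literature.AlgebraicGeometry.AbelianSchemes

end
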